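import Summits.BirchSwinnertonDyer.Rank1Residual.X11b.BDPRouteErratumData
import Summits.BirchSwinnertonDyer.Rank1Residual.X11b.BDPRouteOpenInputDegenerateFrame
import Summits.BirchSwinnertonDyer.Rank1Residual.X11b.CongruenceLimitOneSided
import Summits.BirchSwinnertonDyer.Rank1Residual.X11b.FittingOfNoFiniteSubmodule
import Summits.BirchSwinnertonDyer.Rank1Residual.X11b.AnticyclotomicModuleFinite
import Summits.BirchSwinnertonDyer.Rank1Residual.X2.HidaLimitCongruenceAlgebra
import Mathlib.Algebra.Category.ModuleCat.Basic
import HarnessLib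

/-!
# Route `ErratumRoadFive`, crux `IMCDivAtErratumDataAll` (item stmt-BirchSwinnertonDyer-19270): the
# ONE-SIDED CONGRUENCE GLUE — erratum-shaped congruence data at every erratum datum ⟹ the crux's
# shape `P2.IMCDivIntCoreFrameAtErratumData W p` ON THE TREE OBJECT `X_ac(E[p^∞])`, for BOTH signs
# of `a_p` by ONE proof (registered stubs `stub_imcDivErratum_nonsplitAtP` / `_splitAtP`)

Cell `bsd-stepL` (run/shared/lean/pub/bsd-stepL/), PART 1b ACCEL seat `bsd-stepL-imc24c` (prover, row
(3) «Eisenstein-congruence divisibility … with `p ∥ N` — one uniform proof»); `--supports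
stmt-BirchSwinnertonDyer-19270` (owner `bsd-stepL-imc-p1` assembles via `IMCDivAtErratumDataAll_of`).
HONEST FRAMING: nothing here is asserted about any curve; the item is NOT closed by this file; BSD is
proved for no pair; every theorem below is CONDITIONAL on the displayed congruence data, whose member
inclusions `(2.5)_m` are, in the only announced derivation at `p ∥ N`, [FW21, Thm. 4.41] (PREPRINT) ∘
[FO12, 7.2.1] ∘ [CGS23, 1.4.5] ∘ [JSW17, 3.4.2] for the CRYSTALLINE members `g_m` (erratum Thm. 2.3);
X11b stays CONSTRUCTION-SHAPED; no label, tier or census count moves. Two `Prop`-valued SHAPES with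
bodies (the data packages; claim-free: they assert nothing, they name what a proof must supply) and
theorems; no named fact; no `sorry`.

## Why (imc24a DONE 17:43Z, imc24c g0 `ROAD3-U31-imc24c.md`, imc-p1 g6 `SPEC-19270-RoadFF-objects` concur)

Every COMMUTATIVE-ALGEBRA step of the erratum's proof of its Thm. 1.1 (p. 4, "the argument in
[Ski16, p. 192] applies verbatim") is a kernel theorem of the tree (two-sided:
`AcSelmer.XAc.isTorsion_and_charIdeal_eq_of_congruences_printed`; one-sided over ONE ring:
`CongruenceLimit.PowerSeriesDVR.charIdeal_le_span_of_congruences_printed`; across a ring map: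
`X2.HidaLimitAlgebra.map_le_span_of_oneSided_congruences`, cell bsd-eis). MISSING was the last mile
the crux consumes: the ONE-SIDED transfer ON THE CONSTRUCTED MODULE `AcSelmer.XAc (W.baseChange K) p
κ 𝔭 Σ γ` across the TWO rings of erratum p. 4 (`Λ = ℤ_p⟦T⟧` Selmer side, `Λ^{ur} = R₀⟦T⟧` for the
`L`-functions), the one-sided `Σ`-removal, and the passage to the receptacle `𝓞_{ℂ_p}⟦T⟧` of
`P2.IMCDivIntCoreFrameAtErratumData` — uniformly in the sign of `a_p` (the descent is SIGN-BLIND: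
`a_p = ±1` enters only (iv) `E(ℚ_p)[p] = 0`, a binder of `ErratumHypotheses` on both stubs). Once the
member data exist (imc-p1 SPEC (D1)–(D3), (F1)–(F7)), BOTH registered stubs follow BY NAME from §4.

## What this file proves (dictionary: `Λ = IwasawaAlgebra p = ℤ_p⟦T⟧`, `R₀ = unrIntegers p`,
## `Λ^{ur} = UnrSeries p = R₀⟦T⟧`, `φ = PowerSeries.map toUnr : Λ → Λ^{ur}`, `X^Σ = XAc (E_K) p κ 𝔭 Σ γ`)

* §1 **`AcSelmer.XAc.charIdeal_map_toUnr_le_span_of_oneSided_congruences`** — ON `X^Σ` (any finite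
  `Σ`, any elliptic `E/K`, any `ℤ_p`-extension `κ` with generator `γ`, any `𝔭`): from `X^Σ` torsion
  [CTL: Cas18 Thm. 2.3] with no nonzero finite submodule [erratum Lemma 2.2 / JSW17 Prop. 3.3.6],
  member modules `N_m` (finite over `Λ`) with `Λ`-isomorphisms `X^Σ/p^m ≅ N_m/p^m` [(b) Hida theory +
  Lemma 2.1, dualised], member inclusions in their PRINTED shape `N_m torsion → Ch_Λ(N_m)·Λ^{ur} ⊆
  (L_m)` [(2.5)_m] and congruences `(L_m) + (p^m) = (L^Σ) + (p^m)` in `Λ^{ur}` [(c), Cas20 Thm. 2.11]: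
  **`Ch_Λ(X^Σ)·Λ^{ur} ⊆ (L^Σ)`** (X2's two-ring Krull limit + `Fitt_Λ = Ch_Λ` on `X^Σ`).
* §2 **`AcSelmer.XAc.charIdeal_map_toUnr_le_span_of_imprimitive`** — ONE-SIDED `Σ`-removal:
  `Ch_Λ(X^∅)·(P_Σ) ⊆ Ch_Λ(X^Σ)` [the kernel of `X^Σ ↠ X^∅` has characteristic ideal DIVIDING
  `∏_{w∈Σ} P_w`: GV00 Prop. 2.4 / Cas18 (3.1) / JSW17 Cor. 3.4.2, injective half only], `(L^Σ) =
  (L·φ P_Σ)` and `P_Σ ≠ 0` give `Ch_Λ(X^∅)·Λ^{ur} ⊆ (L)` (cancellation in the domain `R₀⟦T⟧`).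
* §3 **`P2.exists_intCoreFrame_of_unrFrame_of_charIdeal_map_le`** — the last mile to the crux's
  currency: an `R₀`-frame `(Ω_K ≠ 0, Ω_p ∈ R₀ˣ, L)` with Castella's interpolation property and
  `Ch_Λ(X^∅)·Λ^{ur} ⊆ (L)` give the ♭-frame `(Ω_K, Ω_p, Q = L read in 𝓞_{ℂ_p}⟦T⟧)` with `‖Ω_p‖ = 1`,
  `R1.IsBDPLFunctionInt` and `Ch_Λ(X^∅)·𝓞_{ℂ_p}⟦T⟧ ⊆ (Q)` — EXACTLY the conjunct of
  `P2.IMCDivIntCoreFrameAtErratumData` (multr1-p1's `R1.isBDPLFunctionInt_map`,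
  `R1.ideal_map_le_span_map_of_le`). This is where BOTH one-sided roads end: Road FF (this file's
  §1–§2) and bdp's Road HF ∕ Thm. B′ (`FamilySpecialization.map_charIdeal_le_span_singleton_of_familyControl`,
  whose output has the shape of §3's input).
* §4 the SHAPES **`P2.OneSidedCongruenceDataAt`** (per datum: frame + §1-inputs + §2-inputs, members
  bundled as `ModuleCat Λ`) and **`P2.OneSidedCongruenceDataAtErratumData W p`** (the same at every
  erratum datum — binders of the crux VERBATIM), and the glue theorems
  **`P2.imcDivIntCoreFrameAtErratumData_of_oneSidedCongruenceData`** :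
  `P2.OneSidedCongruenceDataAtErratumData W p → P2.IMCDivIntCoreFrameAtErratumData W p` (EVERY pair,
  both signs), **`P2.stub_imcDivErratum_nonsplitAtP_of_oneSidedCongruenceData`** and
  **`P2.stub_imcDivErratum_splitAtP_of_oneSidedCongruenceData`** — conclusions = the two REGISTERED
  stub signatures of crux 19270 (skeleton `Lines/birth.lean` v2, sha16 3b33bb76) VERBATIM: ONE proof
  serves both (the sign hypothesis is not used).

INPUT, not proved (where it is print): the frame (Cas18 Thm. 3.1 = A206, semistable; bdp THEOREM C♯
at erratum data); torsion of `X^Σ` (CTL; at `Σ = ∅` the cell theorem `controlUpperOnTreeAt_of_isErratumField`);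
Lemma 2.2 for `X^Σ_ac(E[p^∞])`; the members `N_m = X^Σ_ac(A_{g_m})` with (b)+Lemma 2.1, (2.5)_m (the ONE
PRE brick) and (c); the `Σ`-removal datum `P_Σ`. Coefficient convention (as in every congruence file
of the tree): members are `Λ`-modules, `L_m ∈ R₀⟦T⟧` (Hecke fields of the `g_m` read inside `R₀`).
-- TODO(general form): members over `Λ_{𝒪_m}` (`𝒪_m/ℤ_p` possibly ramified), conclusion descended to
-- `R₀⟦T⟧` by faithful flatness of `R₀⟦T⟧ → 𝒪_m^{ur}⟦T⟧` ([Ski16, §3.1]); §1 is unchanged per `m`.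

References: [Castella2018Erratum] Lemmas 2.1–2.2, Thm. 2.3, (2.4)–(2.5), proof of Thm. 1.1 (pp. 2–4);
[Skinner2016PacificMC] §3.1 (p. 192); [Castella2018] Def. 2.2, Thm. 2.3, (3.1), Thm. 3.1 (arXiv:1704.06608
pp. 5, 9, 11); [Castella2020JIMJ] Thm. 2.11; [GreenbergVatsal2000] Prop. 2.4; [JetchevSkinnerWan2017]
Cor. 3.4.2, Prop. 3.3.6; [FouquetWan2021] Thm. 4.41 (PREPRINT). Memos: imc-p1 SPEC (evidence #12 on
19270), imc24c `ROAD3-U31-imc24c.md` v2 (#16), bdp `proof/PROOF-BDP.md` §5 Thm. B, §13 Thm. B′.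
-/

set_option autoImplicit false

noncomputable section

open scoped Classical

open WeierstrassCurve NumberField IsDedekindDomain Field PowerSeries
open Literature.NumberTheory.EllipticCurves Literature.NumberTheory.EllipticCurves.GreenbergSelmer
  Literature.NumberTheory.EllipticCurves.ModularForms Literature.NumberTheory.EllipticCurves.Rank1Residual
  Literature.NumberTheory.EllipticCurves.Rank1Residual.Typed Literature.NumberTheory.EllipticCurves.Castella2018
  Literature.NumberTheory.EllipticCurves.Module Literature.NumberTheory.GaloisRepresentations
  Literature.NumberTheory.GaloisCohomology Literature.RingTheory.FittingIdeal
open Summit.BirchSwinnertonDyer.Rank1Residual.X11b.AcSelmer Summit.BirchSwinnertonDyer.Rank1Residual.X11b.Halves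
  Summit.BirchSwinnertonDyer.Rank1Residual.X2

namespace Summit.BirchSwinnertonDyer.Rank1Residual.X11b

/-! ### §1 The one-sided congruence limit ON `X_ac^Σ(E[p^∞])`, two rings `Λ → R₀⟦T⟧` -/

section Transfer

variable {K : Type} [Field K] [NumberField K] (E : WeierstrassCurve K) [E.IsElliptic]
  (p : ℕ) [Fact p.Prime] (κ : ZpExtension K p) (𝔭 : HeightOneSpectrum (𝓞 K))
  {S : Set (HeightOneSpectrum (𝓞 K))} (γ : Field.absoluteGaloisGroup K) [Fact (κ.IsTopGenerator γ)]

/-- **Erratum p. 4 ∕ [Ski16, p. 192] read ONE-SIDEDLY, ON THE TREE OBJECT `X^Σ = X_ac^Σ(E[p^∞])`,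
across `φ : Λ = ℤ_p⟦T⟧ → Λ^{ur} = R₀⟦T⟧`.** Inputs: `Σ` finite (so `X^Σ` is finitely generated,
`XAc.module_finite`); `X^Σ` is `Λ`-torsion [control, Cas18 Thm. 2.3] with no nonzero submodule of
finite length [erratum Lemma 2.2 ∕ JSW17 Prop. 3.3.6]; for every `m ≥ 1` a finite `Λ`-module `N_m`
(`X^Σ_ac(A_{g_m})`), a `Λ`-isomorphism `X^Σ/p^m ≅ N_m/p^m` [(b) `T_{g_m}/p^m ≃ T/p^m` + Lemma 2.1,
dualised], the member inclusion in its PRINTED shape `N_m torsion → Ch_Λ(N_m)·Λ^{ur} ⊆ (L_m)`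
[(2.5) for `g_m`] and `(L_m) + (p^m) = (L^Σ) + (p^m)` in `Λ^{ur}` [(c), Cas20 Thm. 2.11]. Output:
`Ch_Λ(X^Σ)·Λ^{ur} ⊆ (L^Σ)`. Proof: Krull's two-ring limit of cell bsd-eis
(`X2.HidaLimitAlgebra.map_le_span_of_oneSided_congruences`, `(p) ⊆ Jac(R₀⟦T⟧)` since `R₀` is a DVR)
gives `Fitt_Λ(X^Σ)·Λ^{ur} ⊆ (L^Σ)`, and `Fitt_Λ(X^Σ) = Ch_Λ(X^Σ)`
(`CongruenceLimit.fittingIdeal_zero_eq_charIdeal_of_forall_length`). No `L ≠ 0`, no torsion-ness or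
Lemma 2.2 for the `N_m`, no Euler system. Pure algebra on the constructed module; CONDITIONAL on the
displayed inputs. [cite: Castella2018Erratum, Lemmas 2.1–2.2 and proof of Thm. 1.1 (p. 4), read one-sidedly]
[cite: Skinner2016PacificMC, §3.1 (p. 192)] -/
theorem AcSelmer.XAc.charIdeal_map_toUnr_le_span_of_oneSided_congruences (hS : S.Finite)
    (hT : Module.IsTorsion (IwasawaAlgebra p) (XAc E p κ 𝔭 S γ))
    (hnf : ∀ N' : Submodule (IwasawaAlgebra p) (XAc E p κ 𝔭 S γ),
      Module.length (IwasawaAlgebra p) N' ≠ ⊤ → N' = ⊥)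
    (N : ℕ → Type) [∀ m, AddCommGroup (N m)] [∀ m, Module (IwasawaAlgebra p) (N m)]
    [∀ m, Module.Finite (IwasawaAlgebra p) (N m)] (LS : UnrSeries p) (Lm : ℕ → UnrSeries p)
    (e : ∀ m : ℕ, 1 ≤ m →
      ((XAc E p κ 𝔭 S γ ⧸ ((Ideal.span {(PowerSeries.C (p : ℤ_[p]) : IwasawaAlgebra p)}) ^ m •
          (⊤ : Submodule (IwasawaAlgebra p) (XAc E p κ 𝔭 S γ)))) ≃ₗ[IwasawaAlgebra p]
        (N m ⧸ ((Ideal.span {(PowerSeries.C (p : ℤ_[p]) : IwasawaAlgebra p)}) ^ m •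
          (⊤ : Submodule (IwasawaAlgebra p) (N m))))))
    (hF : ∀ m : ℕ, 1 ≤ m → Module.IsTorsion (IwasawaAlgebra p) (N m) →
      (Module.charIdeal (IwasawaAlgebra p) (N m)).map (PowerSeries.map (toUnr p)) ≤ Ideal.span {Lm m})
    (hc : ∀ m : ℕ, 1 ≤ m →
      Ideal.span {Lm m} ⊔ (Ideal.span {(PowerSeries.C ((p : ℕ) : unrIntegers p) : UnrSeries p)}) ^ m =
        Ideal.span {LS} ⊔ (Ideal.span {(PowerSeries.C ((p : ℕ) : unrIntegers p) : UnrSeries p)}) ^ m) :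
    (XAc.charIdeal E p κ 𝔭 S γ).map (PowerSeries.map (toUnr p)) ≤ Ideal.span {LS} := by
  haveI : Module.Finite (IwasawaAlgebra p) (XAc E p κ 𝔭 S γ) := XAc.module_finite κ 𝔭 S γ hS
  haveI := HidaLimitAlgebra.isNoetherianRing_unrSeries (p := p)
  have hI : (Ideal.span {(PowerSeries.C (p : ℤ_[p]) : IwasawaAlgebra p)}).map
      (PowerSeries.map (toUnr p)) ≤ (⊥ : Ideal (UnrSeries p)).jacobson := by
    rw [HidaLimitAlgebra.map_span_C_p]
    exact HidaLimitAlgebra.span_C_p_le_jacobson_unrSeries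
  have hc' : ∀ m : ℕ, 1 ≤ m → Ideal.span {Lm m} ⊔
      ((Ideal.span {(PowerSeries.C (p : ℤ_[p]) : IwasawaAlgebra p)}).map
        (PowerSeries.map (toUnr p))) ^ m = Ideal.span {LS} ⊔
      ((Ideal.span {(PowerSeries.C (p : ℤ_[p]) : IwasawaAlgebra p)}).map
        (PowerSeries.map (toUnr p))) ^ m := by
    intro m hm
    rw [HidaLimitAlgebra.map_span_C_p]
    exact hc m hm
  have hF' : ∀ m : ℕ, 1 ≤ m →
      (Module.fittingIdeal (IwasawaAlgebra p) (N m) 0).map (PowerSeries.map (toUnr p)) ≤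
        Ideal.span {Lm m} := by
    intro m hm
    by_cases hNt : Module.IsTorsion (IwasawaAlgebra p) (N m)
    · exact HidaLimitAlgebra.map_fittingIdeal_le_of_map_charIdeal_le _ hNt (hF m hm hNt)
    · have h0 : Module.fittingIdeal (IwasawaAlgebra p) (N m) 0 = ⊥ :=
        le_bot_iff.mp (Module.fittingIdeal_zero_le_annihilator.trans
          (Module.annihilator_eq_bot_of_not_isTorsion hNt).le)
      rw [h0, Ideal.map_bot]
      exact bot_le
  have key := HidaLimitAlgebra.map_le_span_of_oneSided_congruences (PowerSeries.map (toUnr p))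
    (Ideal.span {(PowerSeries.C (p : ℤ_[p]) : IwasawaAlgebra p)}) N hI
    (le_refl (Module.fittingIdeal (IwasawaAlgebra p) (XAc E p κ 𝔭 S γ) 0)) LS Lm e hF' hc'
  have hFC := CongruenceLimit.fittingIdeal_zero_eq_charIdeal_of_forall_length p (XAc E p κ 𝔭 S γ)
    hT hnf
  change (Module.charIdeal (IwasawaAlgebra p) (XAc E p κ 𝔭 S γ)).map (PowerSeries.map (toUnr p)) ≤ _
  rw [← hFC]
  exact key

/-! ### §2 One-sided `Σ`-removal -/

omit [E.IsElliptic] in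
/-- **One-sided `Σ`-removal on `X_ac`** ("it suffices to prove the result for `X^Σ` and `L^Σ`",
the injective half only). If `Ch_Λ(X^∅)·(P_Σ) ⊆ Ch_Λ(X^Σ)` in `Λ` [the kernel of `X^Σ ↠ X^∅` is a
quotient of the dual of `⊕_{w∈Σ} H¹(K_{∞,w}, E[p^∞])`, whose characteristic ideal is `(∏_w P_w)`:
GV00 Prop. 2.4 ∕ Cas18 (3.1)], `(L^Σ) = (L · φ P_Σ)` in `Λ^{ur}` [same Euler factors on the analytic
side] with `P_Σ ≠ 0`, and `Ch_Λ(X^Σ)·Λ^{ur} ⊆ (L^Σ)`, then `Ch_Λ(X^∅)·Λ^{ur} ⊆ (L)`: cancel the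
nonzero principal factor `(φ P_Σ)` in the domain `R₀⟦T⟧` (`φ` is injective). Pure algebra.
[cite: Castella2018, display (3.1) and the sentence after Thm. 2.3 (arXiv:1704.06608 pp. 5, 11)]
[cite: GreenbergVatsal2000, Prop. 2.4] [cite: JetchevSkinnerWan2017, Cor. 3.4.2] -/
theorem AcSelmer.XAc.charIdeal_map_toUnr_le_span_of_imprimitive {PS : IwasawaAlgebra p}
    (hPS : PS ≠ 0)
    (hX : XAc.charIdeal E p κ 𝔭 ∅ γ * Ideal.span {PS} ≤ XAc.charIdeal E p κ 𝔭 S γ)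
    {L LS : UnrSeries p}
    (hLS : Ideal.span {LS} = Ideal.span {L * PowerSeries.map (toUnr p) PS})
    (hdiv : (XAc.charIdeal E p κ 𝔭 S γ).map (PowerSeries.map (toUnr p)) ≤ Ideal.span {LS}) :
    (XAc.charIdeal E p κ 𝔭 ∅ γ).map (PowerSeries.map (toUnr p)) ≤ Ideal.span {L} := by
  have hPS' : PowerSeries.map (toUnr p) PS ≠ 0 := fun h ↦
    hPS (map_toUnr_injective (by rw [h, map_zero]))
  have h1 : (XAc.charIdeal E p κ 𝔭 ∅ γ).map (PowerSeries.map (toUnr p)) *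
      Ideal.span {PowerSeries.map (toUnr p) PS} ≤ Ideal.span {LS} := by
    have h := Ideal.map_mono (f := PowerSeries.map (toUnr p)) hX
    rw [Ideal.map_mul, Ideal.map_span, Set.image_singleton] at h
    exact h.trans hdiv
  have h2 : Ideal.span {PowerSeries.map (toUnr p) PS} *
      (XAc.charIdeal E p κ 𝔭 ∅ γ).map (PowerSeries.map (toUnr p)) ≤
      Ideal.span {PowerSeries.map (toUnr p) PS} * Ideal.span {L} := by
    rw [mul_comm, mul_comm (Ideal.span {PowerSeries.map (toUnr p) PS}) (Ideal.span {L}),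
      Ideal.span_singleton_mul_span_singleton, ← hLS]
    exact h1
  exact (Ideal.span_singleton_mul_right_mono hPS').mp h2

end Transfer

/-! ### §3 The last mile: from `R₀⟦T⟧` to the crux's receptacle `𝓞_{ℂ_p}⟦T⟧` -/

section LastMile

variable {K : Type} [Field K] [NumberField K] (W : WeierstrassCurve ℚ) (p : ℕ) [Fact p.Prime]
  (κ : ZpExtension K p) (𝔭 : HeightOneSpectrum (𝓞 K)) (γ : Field.absoluteGaloisGroup K)
  [Fact (κ.IsTopGenerator γ)] (ι : PadicAlgCl p ≃+* ℂ) {N : ℕ}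
  (f : CuspForm (CongruenceSubgroup.Gamma0 N) 2)

/-- **The last mile, where BOTH one-sided roads end.** An `R₀`-frame `(Ω_K ≠ 0, Ω_p ∈ R₀ˣ, L ∈ R₀⟦T⟧)`
with Castella's interpolation property [Cas18 Thm. 3.1 shape] and the one-sided divisibility
`Ch_Λ(X_ac^∅(E[p^∞]))·R₀⟦T⟧ ⊆ (L)` give the ♭-frame conjunct of `P2.IMCDivIntCoreFrameAtErratumData`:
`(Ω_K, Ω_p, Q := L read in 𝓞_{ℂ_p}⟦T⟧)` with `‖Ω_p‖ = 1`, `R1.IsBDPLFunctionInt` and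
`Ch_Λ(X_ac^∅)·𝓞_{ℂ_p}⟦T⟧ ⊆ (Q)` (multr1-p1's `R1.isBDPLFunctionInt_map`, `R1.ideal_map_le_span_map_of_le`).
The input divisibility is the output of §1–§2 (Road FF) and of bdp's Thm. B′
(`FamilySpecialization.map_charIdeal_le_span_singleton_of_familyControl`, Road HF).
[cite: Castella2018, Thm. 3.1 (arXiv:1704.06608 p. 9)] [cite: Castella2018Erratum, (2.4)–(2.5) (p. 4)] -/
theorem P2.exists_intCoreFrame_of_unrFrame_of_charIdeal_map_le {ΩK : ℂ} {Ωp : (unrIntegers p)ˣ}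
    {L : UnrSeries p} (hΩ : ΩK ≠ 0)
    (hL : IsBDPLFunction ι 𝔭 κ γ f ΩK ((Ωp : unrIntegers p) : ℂ_[p]) L)
    (hdiv : (XAc.charIdeal (W.baseChange K) p κ 𝔭 ∅ γ).map (PowerSeries.map (toUnr p)) ≤
      Ideal.span {L}) :
    ∃ (ΩK : ℂ) (Ωp : ℂ_[p]) (Q : PowerSeries 𝓞_ℂ_[p]), ΩK ≠ 0 ∧ ‖Ωp‖ = 1 ∧
      R1.IsBDPLFunctionInt p ι 𝔭 κ γ f ΩK Ωp Q ∧
      (XAc.charIdeal (W.baseChange K) p κ 𝔭 ∅ γ).map (PowerSeries.map (R1.toCpInt p)) ≤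
        Ideal.span {Q} :=
  ⟨ΩK, ((Ωp : unrIntegers p) : ℂ_[p]), PowerSeries.map (R1.unrToCpInt p) L, hΩ,
    norm_coe_units_unrIntegers p Ωp, R1.isBDPLFunctionInt_map hL,
    R1.ideal_map_le_span_map_of_le p hdiv⟩

end LastMile

/-! ### §4 The data packages (shapes) and the glue to the crux and to both registered stubs -/

section Shapes

variable {K : Type} [Field K] [NumberField K] (W : WeierstrassCurve ℚ) (p : ℕ) [Fact p.Prime]
  (κ : ZpExtension K p) (𝔭 : HeightOneSpectrum (𝓞 K)) (γ : Field.absoluteGaloisGroup K)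
  [Fact (κ.IsTopGenerator γ)] (ι : PadicAlgCl p ≃+* ℂ) {N : ℕ}
  (f : CuspForm (CongruenceSubgroup.Gamma0 N) 2)

/-- **ONE-SIDED CONGRUENCE DATA AT A DATUM (shape; asserts nothing).** For `E = W_K`, a prime `𝔭`,
a `ℤ_p`-extension `κ` with generator `γ`, an embedding datum `ι` and a weight-2 form `f`, THE
INGREDIENTS OF ERRATUM p. 4 READ ONE-SIDEDLY, in the tree's vocabulary:
* an `R₀`-frame `(Ω_K ≠ 0, Ω_p ∈ R₀ˣ, L ∈ R₀⟦T⟧)` with `IsBDPLFunction ι 𝔭 κ γ f Ω_K Ω_p L`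
  [Cas18 Thm. 3.1 — A206 ∕ THEOREM C♯];
* a finite set `Σ` of places with `X^Σ = X_ac^Σ(E[p^∞])` `Λ`-torsion [CTL] and without nonzero
  finite-length submodule [erratum Lemma 2.2];
* one-sided `Σ`-removal data: `P_Σ ∈ Λ`, `P_Σ ≠ 0`, `Ch_Λ(X^∅)·(P_Σ) ⊆ Ch_Λ(X^Σ)`, and the
  `Σ`-imprimitive `L^Σ ∈ R₀⟦T⟧` with `(L^Σ) = (L·P_Σ)` [GV00 2.4 ∕ Cas18 (3.1) ∕ JSW17 3.4.2];
* members: finite `Λ`-modules `N_m` (`X^Σ_ac(A_{g_m})`, bundled as `ModuleCat Λ`), `L_m ∈ R₀⟦T⟧`,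
  `Λ`-isomorphisms `X^Σ/p^m ≅ N_m/p^m` [(a)(b) Hida + Lemma 2.1], the PRINTED one-sided inclusions
  `N_m torsion → Ch_Λ(N_m)·R₀⟦T⟧ ⊆ (L_m)` [(2.5)_m — at `p ∥ N`: FW21 Thm. 4.41 for the crystalline
  `g_m`, PREPRINT] and `(L_m) + (p^m) = (L^Σ) + (p^m)` [(c) Cas20 Thm. 2.11].
A predicate; NEVER a theorem in this cell; any proof of it at erratum data is PREPRINT-conditional today.
[cite: Castella2018Erratum, (a)–(c), Lemmas 2.1–2.2, (2.5), proof of Thm. 1.1 (pp. 2–4) (shape only; nothing asserted)]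
[claim: Castella2018Erratum, status: under-review]
[cite: Castella2018, Def. 2.2, (3.1), Thm. 3.1 (arXiv:1704.06608 pp. 5, 9, 11) (shape only; nothing asserted)] -/
@[conjecture]
def P2.OneSidedCongruenceDataAt : Prop :=
  ∃ (ΩK : ℂ) (Ωp : (unrIntegers p)ˣ) (L : UnrSeries p) (S : Set (HeightOneSpectrum (𝓞 K)))
    (PS : IwasawaAlgebra p) (LS : UnrSeries p) (Nm : ℕ → ModuleCat.{0} (IwasawaAlgebra p))
    (Lm : ℕ → UnrSeries p),
    ΩK ≠ 0 ∧ IsBDPLFunction ι 𝔭 κ γ f ΩK ((Ωp : unrIntegers p) : ℂ_[p]) L ∧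
    S.Finite ∧ Module.IsTorsion (IwasawaAlgebra p) (XAc (W.baseChange K) p κ 𝔭 S γ) ∧
    (∀ N' : Submodule (IwasawaAlgebra p) (XAc (W.baseChange K) p κ 𝔭 S γ),
      Module.length (IwasawaAlgebra p) N' ≠ ⊤ → N' = ⊥) ∧
    PS ≠ 0 ∧ XAc.charIdeal (W.baseChange K) p κ 𝔭 ∅ γ * Ideal.span {PS} ≤
      XAc.charIdeal (W.baseChange K) p κ 𝔭 S γ ∧
    Ideal.span {LS} = Ideal.span {L * PowerSeries.map (toUnr p) PS} ∧
    (∀ m : ℕ, Module.Finite (IwasawaAlgebra p) (Nm m)) ∧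
    (∀ m : ℕ, 1 ≤ m → Nonempty
      ((XAc (W.baseChange K) p κ 𝔭 S γ ⧸
          ((Ideal.span {(PowerSeries.C (p : ℤ_[p]) : IwasawaAlgebra p)}) ^ m •
            (⊤ : Submodule (IwasawaAlgebra p) (XAc (W.baseChange K) p κ 𝔭 S γ)))) ≃ₗ[IwasawaAlgebra p]
        ((Nm m) ⧸ ((Ideal.span {(PowerSeries.C (p : ℤ_[p]) : IwasawaAlgebra p)}) ^ m •
          (⊤ : Submodule (IwasawaAlgebra p) (Nm m)))))) ∧
    (∀ m : ℕ, 1 ≤ m → Module.IsTorsion (IwasawaAlgebra p) (Nm m) →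
      (Module.charIdeal (IwasawaAlgebra p) (Nm m)).map (PowerSeries.map (toUnr p)) ≤ Ideal.span {Lm m}) ∧
    (∀ m : ℕ, 1 ≤ m →
      Ideal.span {Lm m} ⊔ (Ideal.span {(PowerSeries.C ((p : ℕ) : unrIntegers p) : UnrSeries p)}) ^ m =
        Ideal.span {LS} ⊔ (Ideal.span {(PowerSeries.C ((p : ℕ) : unrIntegers p) : UnrSeries p)}) ^ m)

variable {W p κ 𝔭 γ ι f}

/-- **At a datum: one-sided congruence data ⟹ an `R₀`-frame with the ONE-SIDED divisibility
`Ch_Λ(X_ac^∅(E[p^∞]))·R₀⟦T⟧ ⊆ (L)`** — the `R₀`-level conclusion of erratum p. 4 read one-sidedly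
(§1 on `X^Σ`, then §2). CONDITIONAL on the data. [cite: Castella2018Erratum, proof of Thm. 1.1 (p. 4) and (2.5)]
[cite: Skinner2016PacificMC, §3.1 (p. 192)] -/
theorem P2.exists_unrFrame_charIdeal_map_le_of_oneSidedCongruenceDataAt [W.IsElliptic]
    (h : P2.OneSidedCongruenceDataAt W p κ 𝔭 γ ι f) :
    ∃ (ΩK : ℂ) (Ωp : (unrIntegers p)ˣ) (L : UnrSeries p), ΩK ≠ 0 ∧
      IsBDPLFunction ι 𝔭 κ γ f ΩK ((Ωp : unrIntegers p) : ℂ_[p]) L ∧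
      (XAc.charIdeal (W.baseChange K) p κ 𝔭 ∅ γ).map (PowerSeries.map (toUnr p)) ≤
        Ideal.span {L} := by
  obtain ⟨ΩK, Ωp, L, S, PS, LS, Nm, Lm, hΩ, hL, hS, hT, hnf, hPS, hX, hLS, hfin, he, hF, hc⟩ := h
  haveI : ∀ m, Module.Finite (IwasawaAlgebra p) (Nm m) := hfin
  refine ⟨ΩK, Ωp, L, hΩ, hL, ?_⟩
  refine AcSelmer.XAc.charIdeal_map_toUnr_le_span_of_imprimitive (W.baseChange K) p κ 𝔭 γ hPS hX
    hLS ?_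
  exact AcSelmer.XAc.charIdeal_map_toUnr_le_span_of_oneSided_congruences (W.baseChange K) p κ 𝔭 γ
    hS hT hnf (fun m ↦ Nm m) LS Lm (fun m hm ↦ (he m hm).some) hF hc

/-- **At a datum: one-sided congruence data ⟹ the ♭-frame conjunct of the crux** (§1 + §2 + §3).
CONDITIONAL on the data. [cite: Castella2018Erratum, (2.4)–(2.5) and proof of Thm. 1.1 (p. 4)] -/
theorem P2.exists_intCoreFrame_of_oneSidedCongruenceDataAt [W.IsElliptic]
    (h : P2.OneSidedCongruenceDataAt W p κ 𝔭 γ ι f) :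
    ∃ (ΩK : ℂ) (Ωp : ℂ_[p]) (Q : PowerSeries 𝓞_ℂ_[p]), ΩK ≠ 0 ∧ ‖Ωp‖ = 1 ∧
      R1.IsBDPLFunctionInt p ι 𝔭 κ γ f ΩK Ωp Q ∧
      (XAc.charIdeal (W.baseChange K) p κ 𝔭 ∅ γ).map (PowerSeries.map (R1.toCpInt p)) ≤
        Ideal.span {Q} := by
  obtain ⟨ΩK, Ωp, L, hΩ, hL, hdiv⟩ := P2.exists_unrFrame_charIdeal_map_le_of_oneSidedCongruenceDataAt h
  exact P2.exists_intCoreFrame_of_unrFrame_of_charIdeal_map_le W p κ 𝔭 γ ι f hΩ hL hdiv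

end Shapes

section OnTree

variable (W : WeierstrassCurve ℚ) [W.IsElliptic] [W.IsGloballyMinimal] (p : ℕ) [Fact p.Prime]

/-- **ONE-SIDED CONGRUENCE DATA AT EVERY ERRATUM DATUM of `(W, p)` (shape; asserts nothing)** —
the binders of the crux `P2.IMCDivIntCoreFrameAtErratumData W p` VERBATIM (A′-hypotheses
`ErratumHypotheses W p`, `r_an = 1`, a non-split multiplicative `q ≠ p` with `E[p]` ramified, an
erratum field `K` for `q` with [Cas20 §2.5]'s standing hypotheses, a parametrisation datum `Dt` at
level `N_E`, a Heegner datum, a point of infinite order, every anticyclotomic `(κ, γ)`, `ι'`, `e`),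
and at each such datum the package `P2.OneSidedCongruenceDataAt W p κ 𝔭_{ι'} γ ι' Dt.f`. NO sign
condition on `a_p`: the same shape serves both registered stubs. A predicate on `(W, p)`; NEVER a
theorem in this cell. [claim: Castella2018Erratum, status: under-review]
[cite: Castella2018Erratum, Thm. 1.1 (i)–(iv) and its proof (pp. 1, 4) (shape only; nothing asserted)] -/
@[conjecture]
def P2.OneSidedCongruenceDataAtErratumData : Prop :=
  ∀ [NeZero (W.conductorNorm ℤ)] (q : ℕ) [Fact q.Prime] (K : Type) [Field K] [NumberField K]
    (Dt : ModularParametrizationData W (W.conductorNorm ℤ))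
    (H : HeegnerDatum (W.conductorNorm ℤ) (NumberField.discr K)) (w₀ : InfinitePlace K)
    (P : (W.baseChange K).toAffine.Point), ErratumHypotheses W p → W.analyticRank = 1 →
    q ≠ p → Mult W q → ¬ W.HasSplitMultiplicativeReductionAtPrime q →
    ¬ p ∣ padicValInt q W.minimalDiscriminantInt → IsErratumField W K q →
    Cas20Standing K p (W.conductorNorm ℤ / p) →
    WeierstrassCurve.Affine.Point.map w₀.embedding.toRatAlgHom P = heegnerPointComplex Dt H →
    ¬ (p : ℤ) ∣ Dt.c → ¬ IsOfFinAddOrder P →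
    ∀ (κ : ZpExtension K p), κ.IsAnticyclotomic →
      ∀ (γ : Field.absoluteGaloisGroup K) [Fact (κ.IsTopGenerator γ)] (ι' : PadicAlgCl p ≃+* ℂ)
        (e : K →+* ℚ_[p]),
        (∀ k : 𝓞 K, k ∈ (primeOfEmbeddingDatum p ι' w₀.embedding).asIdeal ↔ ‖e (k : K)‖ < 1) →
        P2.OneSidedCongruenceDataAt W p κ (primeOfEmbeddingDatum p ι' w₀.embedding) γ ι' Dt.f

variable {W p}

/-- **THE GLUE (every pair, both signs of `a_p`): one-sided congruence data at every erratum datum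
⟹ `P2.IMCDivIntCoreFrameAtErratumData W p`**, the shape of crux 19270 `IMCDivAtErratumDataAll`.
Per datum: §1 (two-ring one-sided limit on `X^Σ_ac(E[p^∞])`) + §2 (`Σ`-removal) + §3 (receptacle).
The sign of `a_p` is never used (imc24c g0: on this road the ONLY sign-sensitive input is (iv)
`E(ℚ_p)[p] = 0`, inside `ErratumHypotheses`). CONDITIONAL on the data (PREPRINT-derived at `p ∥ N`);
closes nothing by itself. [cite: Castella2018Erratum, proof of Thm. 1.1 (p. 4), read one-sidedly]
[cite: Skinner2016PacificMC, §3.1 (p. 192)] -/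
theorem P2.imcDivIntCoreFrameAtErratumData_of_oneSidedCongruenceData
    (h : P2.OneSidedCongruenceDataAtErratumData W p) : P2.IMCDivIntCoreFrameAtErratumData W p := by
  intro _ q _ K _ _ Dt H w₀ P hE hr hqp hmq hns hvq hK hCas hP hc hinf κ hκ γ _ ι' e he
  exact P2.exists_intCoreFrame_of_oneSidedCongruenceDataAt
    (h q K Dt H w₀ P hE hr hqp hmq hns hvq hK hCas hP hc hinf κ hκ γ ι' e he)

/-- **Registered stub S1 `stub_imcDivErratum_nonsplitAtP` of crux 19270 (skeleton `Lines/birth.lean` v2, sha16 3b33bb76)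
— its signature VERBATIM as conclusion — from one-sided congruence data on every pair.** The non-split hypothesis
is not used: ONE proof for S1 and S2. CONDITIONAL on the data. [cite: Castella2018Erratum, Thm. 1.1 and its proof (pp. 1, 4)] -/
theorem P2.stub_imcDivErratum_nonsplitAtP_of_oneSidedCongruenceData
    (h : ∀ (W : WeierstrassCurve ℚ) [W.IsElliptic] [W.IsGloballyMinimal] (p : ℕ) [Fact p.Prime],
      P2.OneSidedCongruenceDataAtErratumData W p) :
    ∀ (W : WeierstrassCurve ℚ) [W.IsElliptic] [W.IsGloballyMinimal] (p : ℕ) [Fact p.Prime],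
      ¬ W.HasSplitMultiplicativeReductionAtPrime p →
        Summit.BirchSwinnertonDyer.Rank1Residual.X11b.P2.IMCDivIntCoreFrameAtErratumData W p :=
  fun W _ _ p _ _ ↦ P2.imcDivIntCoreFrameAtErratumData_of_oneSidedCongruenceData (h W p)

/-- **Registered stub S2 `stub_imcDivErratum_splitAtP` of crux 19270 (skeleton v2, sha16 3b33bb76) — its signature
VERBATIM as conclusion — from the SAME data** (the split hypothesis is not used). CONDITIONAL on the data. [cite: Castella2018Erratum, Thm. 1.1 and its proof (pp. 1, 4)] -/
theorem P2.stub_imcDivErratum_splitAtP_of_oneSidedCongruenceData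
    (h : ∀ (W : WeierstrassCurve ℚ) [W.IsElliptic] [W.IsGloballyMinimal] (p : ℕ) [Fact p.Prime],
      P2.OneSidedCongruenceDataAtErratumData W p) :
    ∀ (W : WeierstrassCurve ℚ) [W.IsElliptic] [W.IsGloballyMinimal] (p : ℕ) [Fact p.Prime],
      W.HasSplitMultiplicativeReductionAtPrime p →
        Summit.BirchSwinnertonDyer.Rank1Residual.X11b.P2.IMCDivIntCoreFrameAtErratumData W p :=
  fun W _ _ p _ _ ↦ P2.imcDivIntCoreFrameAtErratumData_of_oneSidedCongruenceData (h W p)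

end OnTree

end Summit.BirchSwinnertonDyer.Rank1Residual.X11b

end
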